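import Summits.Parity.BatemanHorn.Theorems.SoloInformedTrapezoidWeights
import Summits.Parity.BatemanHorn.Theorems.SoloInformedSmoothHyperbolaFourier

/-!
# The second variation `V₂(Φ_e) = ∑_m |∇²Φ_e(m)|` of the trapezoid weights

Informed soloist `solo-Parity-informed` (session 143), conjunct `BatemanHorn`, the `d ≥ 3` rung BELOW the parity
wall.  For `Φ_e(m) = W(m)·a_e(m)` (`SoloInformedTrapezoidWeights`) we prove

`V₂(Φ_e) ≤ 2 + D·C₁/(2Δ(X₀+1)) + D·(C₂ + 4C₁)/(2Δ·A)`      (`sum_norm_bdiff_bdiff_trapPhi_le`)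

whenever `|log|g(m+1)| − log|g(m)|| ≤ C₁/m`, `|∇² log|g(m)|| ≤ C₂/m²` (`m ≥ 1`), `|g(m)|` is nondecreasing for
`m ≥ m₀`, and `a_e(m) = 0` for `m ≤ A + 1` (`m₀ ≤ A`, `A ≥ 1`; for irreducible `g` of degree `d` one may take
`A ≍ e^{2/d}`, `SoloInformedLocWeightSupport`).  By the second Leibniz rule the three contributions are: the two unit
kinks of the trapezoid `W` (`≤ 2`); the corner terms `2∑|∇W(m−1)|·|∇a_e(m)| ≤ D·C₁/(2Δ(X₀+1))`, since `∇W(m−1) ≠ 0`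
forces `m ≥ X₀ + 3`; and `D·∑_m |∇²a_e(m)|`, where `a_e = cl(t_e)` and `SoloInformedClampVariation` gives
`∑|∇²cl(t_e)| ≤ ∑|∇²t_e| + 4·sup(t_e(m+2) − t_e(m)) ≤ (C₂ + 4C₁)/(2Δ A)` beyond the vanishing range.  This is the
input of the second-order Abel summation in `m` (decay `h⁻²` of the trapezoid kernel and of its phase variation).
-/

namespace Summit.Parity.BatemanHorn.Theorems

open Finset Polynomial

/-! ### A tail of `∑ 1/k²` -/

/-- `∑_{A ≤ k ≤ B} 1/k² ≤ 2/A` for `A ≥ 1`. [folklore] -/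
theorem sum_Icc_one_div_sq_le_two_div {A : ℕ} (hA : 1 ≤ A) (B : ℕ) :
    ∑ k ∈ Icc A B, 1 / (k : ℝ) ^ 2 ≤ 2 / (A : ℝ) := by
  have hA' : (0 : ℝ) < A := by exact_mod_cast hA
  rcases lt_or_ge B A with hBA | hAB
  · rw [Icc_eq_empty (by omega), sum_empty]; positivity
  · -- `∑_{A ≤ k ≤ B} 1/k² ≤ 2/A − 1/B` by induction on `B ≥ A`
    suffices h : ∑ k ∈ Icc A B, 1 / (k : ℝ) ^ 2 ≤ 2 / (A : ℝ) - 1 / (B : ℝ) by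
      have hB : (0 : ℝ) < B := by exact_mod_cast (show 0 < B by omega)
      linarith [one_div_pos.mpr hB]
    induction B, hAB using Nat.le_induction with
    | base =>
        rw [Icc_self, sum_singleton]
        have h1 : 1 / (A : ℝ) ^ 2 ≤ 1 / A := by
          rw [one_div_le_one_div (by positivity) hA']
          nlinarith [show (1 : ℝ) ≤ A by exact_mod_cast hA]
        have h2 : 2 / (A : ℝ) - 1 / A = 1 / A := by ring
        linarith
    | succ B hAB ih =>
        rw [sum_Icc_succ_top (by omega), Nat.cast_succ]
        have hB : (0 : ℝ) < B := by exact_mod_cast (show 0 < B by omega)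
        have h1 : 1 / ((B : ℝ) + 1) ^ 2 ≤ 1 / B - 1 / ((B : ℝ) + 1) := by
          rw [div_sub_div _ _ hB.ne' (by positivity), one_mul, mul_one, show (B : ℝ) + 1 - B = 1 by ring,
            one_div_le_one_div (by positivity) (by positivity)]
          nlinarith
        linarith

/-! ### Differences of the clamp parameter in `m` -/

/-- `t_e(m') − t_e(m) = (log|g(m')| − log|g(m)|)/(4Δ)`. [this work] -/
theorem locParam_sub_eq (g : ℤ[X]) {Δ : ℝ} (hΔ : 0 < Δ) (e m m' : ℕ) :
    locParam g Δ e m' - locParam g Δ e m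
      = (Real.log ((g.eval (m' : ℤ)).natAbs : ℝ) - Real.log ((g.eval (m : ℤ)).natAbs : ℝ)) / (4 * Δ) := by
  rw [locParam_eq_add g Δ e m m', sqrtAbsEval, sqrtAbsEval, Real.log_sqrt (Nat.cast_nonneg _),
    Real.log_sqrt (Nat.cast_nonneg _)]
  field_simp
  ring

/-! ### The second variation of `a_e` in `m` -/

/-- **`∑_k |a_e(k+2) − 2a_e(k+1) + a_e(k)| ≤ (C₂ + 4C₁)/(2Δ A)`** under the hypotheses of the module docstring.
[this work] -/
theorem sum_abs_locWeight_second_diff_le (g : ℤ[X]) {Δ : ℝ} (hΔ : 0 < Δ) {e : ℕ} (he : 1 ≤ e)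
    (hz : ∀ k : ℕ, g.eval (k : ℤ) ≠ 0) {m₀ A : ℕ} (hA : m₀ ≤ A) (hA1 : 1 ≤ A)
    (hmono : ∀ m m' : ℕ, m₀ ≤ m → m ≤ m' → (g.eval (m : ℤ)).natAbs ≤ (g.eval (m' : ℤ)).natAbs)
    (hvan : ∀ m : ℕ, m ≤ A + 1 → locWeight g Δ e m = 0) {C₁ C₂ : ℝ}
    (hC₁ : ∀ m : ℕ, 1 ≤ m →
      |Real.log ((g.eval ((m : ℤ) + 1)).natAbs : ℝ) - Real.log ((g.eval (m : ℤ)).natAbs : ℝ)| ≤ C₁ / m)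
    (hC₂ : ∀ m : ℕ, 1 ≤ m →
      |Real.log ((g.eval ((m : ℤ) + 2)).natAbs : ℝ) - 2 * Real.log ((g.eval ((m : ℤ) + 1)).natAbs : ℝ)
        + Real.log ((g.eval (m : ℤ)).natAbs : ℝ)| ≤ C₂ / (m : ℝ) ^ 2) (M : ℕ) :
    ∑ k ∈ range M, |locWeight g Δ e (k + 2) - 2 * locWeight g Δ e (k + 1) + locWeight g Δ e k|
      ≤ (C₂ + 4 * C₁) / (2 * Δ * A) := by
  have hA' : (0 : ℝ) < A := by exact_mod_cast hA1
  have hC₁0 : 0 ≤ C₁ := by have := hC₁ 1 le_rfl; simp at this; exact (abs_nonneg _).trans this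
  have hC₂0 : 0 ≤ C₂ := by have := hC₂ 1 le_rfl; simp at this; exact (abs_nonneg _).trans this
  -- the `log|g|` sequence and the clamp parameter
  set L : ℕ → ℝ := fun m => Real.log ((g.eval (m : ℤ)).natAbs : ℝ) with hL
  set t : ℕ → ℝ := fun m => locParam g Δ e m with ht
  have hLt : ∀ m m' : ℕ, t m' - t m = (L m' - L m) / (4 * Δ) := fun m m' => locParam_sub_eq g hΔ e m m'
  have hC₁' : ∀ m : ℕ, 1 ≤ m → |L (m + 1) - L m| ≤ C₁ / m := fun m hm => by
    have := hC₁ m hm; simpa [hL] using this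
  have hC₂' : ∀ m : ℕ, 1 ≤ m → |L (m + 2) - 2 * L (m + 1) + L m| ≤ C₂ / (m : ℝ) ^ 2 := fun m hm => by
    have := hC₂ m hm; simpa [hL] using this
  have ha : ∀ m, locWeight g Δ e m = max 0 (min 1 (t m)) := fun m => locWeight_eq_clamp_locParam g Δ he (hz m)
  have htmono : ∀ i j : ℕ, A ≤ i → i ≤ j → t i ≤ t j := fun i j hi hij =>
    locParam_mono_of_natAbs_le g hΔ e (hz i) (hmono i j (by omega) hij)
  rcases le_or_gt M A with hMA | hAM
  · -- everything vanishes
    refine le_trans (le_of_eq (sum_eq_zero fun k hk => ?_)) (by positivity)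
    rw [mem_range] at hk
    rw [hvan (k + 2) (by omega), hvan (k + 1) (by omega), hvan k (by omega)]
    norm_num
  · obtain ⟨B, rfl⟩ : ∃ B, M = A + B + 1 := ⟨M - A - 1, by omega⟩
    rw [range_eq_Ico, ← sum_Ico_consecutive _ (Nat.zero_le A) (by omega : A ≤ A + B + 1),
      Finset.Ico_add_one_right_eq_Icc]
    have h1 : ∑ k ∈ Ico 0 A, |locWeight g Δ e (k + 2) - 2 * locWeight g Δ e (k + 1) + locWeight g Δ e k| = 0 := by
      refine sum_eq_zero fun k hk => ?_
      rw [mem_Ico] at hk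
      rw [hvan (k + 2) (by omega), hvan (k + 1) (by omega), hvan k (by omega)]
      norm_num
    rw [h1, zero_add]
    simp only [ha]
    -- step bound `t(k+2) − t(k) ≤ C₁/(2ΔA)`
    have hstep : ∀ k ∈ Icc A (A + B), t (k + 2) - t k ≤ C₁ / (2 * Δ * A) := by
      intro k hk
      have hkA : A ≤ k := (mem_Icc.mp hk).1
      have hk1 : 1 ≤ k := hA1.trans hkA
      have hk' : (0 : ℝ) < k := by exact_mod_cast hk1
      rw [hLt]
      have e1 := hC₁' (k + 1) (by omega)
      have e2 := hC₁' k hk1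
      push_cast at e1
      have e3 : C₁ / ((k : ℝ) + 1) ≤ C₁ / A := div_le_div_of_nonneg_left hC₁0 hA' (by exact_mod_cast (by omega))
      have e4 : C₁ / (k : ℝ) ≤ C₁ / A := div_le_div_of_nonneg_left hC₁0 hA' (by exact_mod_cast hkA)
      have e5 : L (k + 2) - L k ≤ 2 * (C₁ / A) := by
        have := abs_le.mp e1; have := abs_le.mp e2
        rw [show k + 1 + 1 = k + 2 from rfl] at *
        linarith
      rw [div_le_iff₀ (by positivity)]
      calc L (k + 2) - L k ≤ 2 * (C₁ / A) := e5
        _ = C₁ / (2 * Δ * A) * (4 * Δ) := by field_simp; ring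
    have hδ : 0 ≤ C₁ / (2 * Δ * A) := by positivity
    refine (sum_abs_clamp_second_diff_le t hδ (fun i j hi hij _ => htmono i j hi hij) hstep).trans ?_
    -- `∑ |∇²t| ≤ C₂/(2ΔA)`
    have h2 : ∑ k ∈ Icc A (A + B), |t (k + 2) - 2 * t (k + 1) + t k| ≤ C₂ / (2 * Δ * A) := by
      have hpt : ∀ k ∈ Icc A (A + B), |t (k + 2) - 2 * t (k + 1) + t k| ≤ C₂ / (4 * Δ) * (1 / (k : ℝ) ^ 2) := by
        intro k hk
        have hk1 : 1 ≤ k := hA1.trans (mem_Icc.mp hk).1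
        have e1 : t (k + 2) - 2 * t (k + 1) + t k = (L (k + 2) - 2 * L (k + 1) + L k) / (4 * Δ) := by
          have := hLt k (k + 2); have := hLt k (k + 1)
          rw [show t (k + 2) - 2 * t (k + 1) + t k = (t (k + 2) - t k) - 2 * (t (k + 1) - t k) by ring,
            hLt k (k + 2), hLt k (k + 1)]
          field_simp
          ring
        rw [e1, abs_div, abs_of_pos (by positivity : (0 : ℝ) < 4 * Δ), div_le_iff₀ (by positivity)]
        calc |L (k + 2) - 2 * L (k + 1) + L k| ≤ C₂ / (k : ℝ) ^ 2 := hC₂' k hk1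
          _ = C₂ / (4 * Δ) * (1 / (k : ℝ) ^ 2) * (4 * Δ) := by field_simp
      refine (sum_le_sum hpt).trans ?_
      rw [← mul_sum]
      calc C₂ / (4 * Δ) * ∑ k ∈ Icc A (A + B), 1 / (k : ℝ) ^ 2 ≤ C₂ / (4 * Δ) * (2 / A) :=
            mul_le_mul_of_nonneg_left (sum_Icc_one_div_sq_le_two_div hA1 _) (by positivity)
        _ = C₂ / (2 * Δ * A) := by field_simp; ring
    rw [add_div]
    have h3 : 4 * (C₁ / (2 * Δ * A)) = 4 * C₁ / (2 * Δ * A) := by ring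
    linarith

/-! ### The two kinks of the trapezoid -/

/-- `|∇²W(k+2)| ≤ 𝟙[k = X₀] + 𝟙[k = X₀ + D]`: the trapezoid count has exactly two unit kinks. [this work] -/
theorem norm_bdiff_bdiff_trapW_add_two_le (X₀ D k : ℕ) :
    ‖bdiff (bdiff (trapW X₀ D)) (k + 2)‖
      ≤ (if k = X₀ then (1 : ℝ) else 0) + (if k = X₀ + D then (1 : ℝ) else 0) := by
  unfold trapW
  rw [bdiff_ofReal_eq, bdiff_ofReal, Complex.norm_real, Real.norm_eq_abs, bdiff_succ_real,
    show k + 1 = k + 1 from rfl, bdiff_succ_real, show k + 2 = (k + 1) + 1 from rfl, bdiff_succ_real]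
  have h1 : (trapCount X₀ D k : ℝ) = trapCount X₀ D (k + 1) + if k ∈ Ioc X₀ (X₀ + D) then (1 : ℝ) else 0 := by
    rw [trapCount_eq_succ_add X₀ D k]; push_cast; split_ifs <;> simp
  have h2 : (trapCount X₀ D (k + 1) : ℝ)
      = trapCount X₀ D (k + 1 + 1) + if k + 1 ∈ Ioc X₀ (X₀ + D) then (1 : ℝ) else 0 := by
    rw [trapCount_eq_succ_add X₀ D (k + 1)]; push_cast; split_ifs <;> simp
  have key : (trapCount X₀ D (k + 1 + 1) : ℝ) - trapCount X₀ D (k + 1)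
      - ((trapCount X₀ D (k + 1) : ℝ) - trapCount X₀ D k)
      = (if k ∈ Ioc X₀ (X₀ + D) then (1 : ℝ) else 0) - (if k + 1 ∈ Ioc X₀ (X₀ + D) then (1 : ℝ) else 0) := by
    rw [h1, h2]; ring
  rw [key]
  by_cases hk1 : k ∈ Ioc X₀ (X₀ + D) <;> by_cases hk2 : k + 1 ∈ Ioc X₀ (X₀ + D) <;>
    simp only [hk1, hk2, if_true, if_false] <;> rw [mem_Ioc] at hk1 hk2
  · norm_num; positivity
  · have hk : k = X₀ + D := by omega
    subst hk; norm_num; split_ifs <;> norm_num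
  · have hk : k = X₀ := by omega
    subst hk; norm_num; split_ifs <;> norm_num
  · norm_num; positivity

/-! ### `V₂(Φ_e)` -/

/-- **SECOND VARIATION OF THE TRAPEZOID WEIGHTS.**
`∑_{m ≤ X₀+D+2} |∇²Φ_e(m)| ≤ 2 + D·C₁/(2Δ(X₀+1)) + D·(C₂ + 4C₁)/(2Δ A)` under the hypotheses of the module
docstring. [this work] -/
theorem sum_norm_bdiff_bdiff_trapPhi_le (g : ℤ[X]) {Δ : ℝ} (hΔ : 0 < Δ) (X₀ D : ℕ) {e : ℕ} (he : 1 ≤ e)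
    (hz : ∀ k : ℕ, g.eval (k : ℤ) ≠ 0) {m₀ A : ℕ} (hA : m₀ ≤ A) (hA1 : 1 ≤ A)
    (hmono : ∀ m m' : ℕ, m₀ ≤ m → m ≤ m' → (g.eval (m : ℤ)).natAbs ≤ (g.eval (m' : ℤ)).natAbs)
    (hvan : ∀ m : ℕ, m ≤ A + 1 → locWeight g Δ e m = 0) {C₁ C₂ : ℝ}
    (hC₁ : ∀ m : ℕ, 1 ≤ m →
      |Real.log ((g.eval ((m : ℤ) + 1)).natAbs : ℝ) - Real.log ((g.eval (m : ℤ)).natAbs : ℝ)| ≤ C₁ / m)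
    (hC₂ : ∀ m : ℕ, 1 ≤ m →
      |Real.log ((g.eval ((m : ℤ) + 2)).natAbs : ℝ) - 2 * Real.log ((g.eval ((m : ℤ) + 1)).natAbs : ℝ)
        + Real.log ((g.eval (m : ℤ)).natAbs : ℝ)| ≤ C₂ / (m : ℝ) ^ 2) :
    ∑ m ∈ range (X₀ + D + 3), ‖bdiff (bdiff (trapPhi g Δ X₀ D e)) m‖
      ≤ 2 + D * C₁ / (2 * Δ * ((X₀ : ℝ) + 1)) + D * ((C₂ + 4 * C₁) / (2 * Δ * A)) := by
  have hC₁0 : 0 ≤ C₁ := by have := hC₁ 1 le_rfl; simp at this; exact (abs_nonneg _).trans this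
  have hX : (0 : ℝ) < (X₀ : ℝ) + 1 := by positivity
  set W := trapW X₀ D with hW
  set a := locC g Δ e with haC
  have ha0 : a 0 = 0 := by simp [haC, locC, hvan 0 (by omega)]
  have ha1 : a 1 = 0 := by simp [haC, locC, hvan 1 (by omega)]
  have hna : ∀ m, ‖a m‖ ≤ 1 := fun m => by rw [haC, norm_locC]; exact locWeight_le_one g Δ e m
  have hnda : ∀ k, ‖bdiff a (k + 1)‖ = |locWeight g Δ e (k + 1) - locWeight g Δ e k| := fun k => by
    simp only [haC]; unfold locC; rw [bdiff_ofReal, Complex.norm_real, Real.norm_eq_abs, bdiff_succ_real]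
  have hndda : ∀ k, ‖bdiff (bdiff a) (k + 2)‖
      = |locWeight g Δ e (k + 2) - 2 * locWeight g Δ e (k + 1) + locWeight g Δ e k| := fun k => by
    simp only [haC]; unfold locC
    rw [bdiff_ofReal_eq, bdiff_ofReal, Complex.norm_real, Real.norm_eq_abs, show k + 2 = (k + 1) + 1 from rfl,
      bdiff_succ_real, bdiff_succ_real, bdiff_succ_real]
    congr 1; ring
  -- pointwise second Leibniz bound
  have hpt : ∀ m, ‖bdiff (bdiff (trapPhi g Δ X₀ D e)) m‖
      ≤ ‖bdiff (bdiff W) m‖ * ‖a m‖ + 2 * (‖bdiff (prev W) m‖ * ‖bdiff a m‖)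
        + ‖prev (prev W) m‖ * ‖bdiff (bdiff a) m‖ := by
    intro m
    have h1 := bdiff_bdiff_mul W a m
    rw [show (fun k => W k * a k) = trapPhi g Δ X₀ D e from rfl] at h1
    rw [h1]
    refine (norm_add₃_le).trans (le_of_eq ?_)
    rw [norm_mul, norm_mul, norm_mul, norm_mul, RCLike.norm_ofNat]
  refine (sum_le_sum fun m _ => hpt m).trans ?_
  rw [sum_add_distrib, sum_add_distrib]
  -- T1: the two kinks
  have hT1 : ∑ m ∈ range (X₀ + D + 3), ‖bdiff (bdiff W) m‖ * ‖a m‖ ≤ 2 := by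
    rw [show X₀ + D + 3 = (X₀ + D + 1) + 1 + 1 from rfl, sum_range_succ', sum_range_succ', ha0, ha1, norm_zero,
      mul_zero, mul_zero, add_zero, add_zero]
    calc ∑ j ∈ range (X₀ + D + 1), ‖bdiff (bdiff W) (j + 1 + 1)‖ * ‖a (j + 1 + 1)‖
        ≤ ∑ j ∈ range (X₀ + D + 1), ((if j = X₀ then (1 : ℝ) else 0) + (if j = X₀ + D then (1 : ℝ) else 0)) :=
          sum_le_sum fun j _ => (mul_le_of_le_one_right (norm_nonneg _) (hna _)).trans
            (norm_bdiff_bdiff_trapW_add_two_le X₀ D j)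
      _ ≤ 1 + 1 := by
          rw [sum_add_distrib, sum_ite_eq', sum_ite_eq']
          exact add_le_add (by split_ifs <;> norm_num) (by split_ifs <;> norm_num)
      _ = 2 := by norm_num
  -- T2: the corner terms
  have hT2 : ∑ m ∈ range (X₀ + D + 3), 2 * (‖bdiff (prev W) m‖ * ‖bdiff a m‖)
      ≤ D * C₁ / (2 * Δ * ((X₀ : ℝ) + 1)) := by
    rw [← mul_sum, show X₀ + D + 3 = (X₀ + D + 1) + 1 + 1 from rfl, sum_range_succ', sum_range_succ']
    have e0 : ‖bdiff (prev W) 0‖ * ‖bdiff a 0‖ = 0 := by simp [bdiff]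
    have e1 : ‖bdiff (prev W) (0 + 1)‖ * ‖bdiff a (0 + 1)‖ = 0 := by
      rw [hnda 0, zero_add, hvan 1 (by omega), hvan 0 (by omega)]; simp
    rw [e0, e1, add_zero, add_zero]
    have hj : ∀ j ∈ range (X₀ + D + 1), ‖bdiff (prev W) (j + 1 + 1)‖ * ‖bdiff a (j + 1 + 1)‖
        ≤ ‖bdiff W (j + 1)‖ * (C₁ / (4 * Δ * ((X₀ : ℝ) + 1))) := by
      intro j _
      rw [← prev_bdiff, prev_succ]
      rcases le_or_gt j X₀ with hjX | hjX
      · -- below the corner `∇W(j+1) = 0`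
        have h0 : ‖bdiff W (j + 1)‖ = 0 := by
          rw [hW, norm_bdiff_trapW_succ, trapCount_of_le_succ (by omega : j ≤ X₀ + 1),
            trapCount_of_le_succ (by omega : j + 1 ≤ X₀ + 1), sub_self]
        rw [h0, zero_mul, zero_mul]
      · refine mul_le_mul_of_nonneg_left ?_ (norm_nonneg _)
        rw [hnda (j + 1)]
        have h1 := abs_locWeight_sub_le g hΔ e (hz (j + 1)) (hz (j + 1 + 1))
        have h2 := hC₁ (j + 1) (by omega)
        push_cast at h1 h2
        have hj1 : (X₀ : ℝ) + 1 ≤ (j : ℝ) + 1 := by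
          have : (X₀ : ℝ) < j := by exact_mod_cast hjX
          linarith
        have h3 : C₁ / ((j : ℝ) + 1) ≤ C₁ / ((X₀ : ℝ) + 1) := div_le_div_of_nonneg_left hC₁0 hX hj1
        calc |locWeight g Δ e (j + 1 + 1) - locWeight g Δ e (j + 1)|
            ≤ |Real.log ((g.eval ((j : ℤ) + 1 + 1)).natAbs : ℝ) - Real.log ((g.eval ((j : ℤ) + 1)).natAbs : ℝ)|
                / (4 * Δ) := h1
          _ ≤ (C₁ / ((X₀ : ℝ) + 1)) / (4 * Δ) := div_le_div_of_nonneg_right (h2.trans h3) (by positivity)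
          _ = C₁ / (4 * Δ * ((X₀ : ℝ) + 1)) := by rw [div_div, mul_comm]
    have h4 : ∑ j ∈ range (X₀ + D + 1), ‖bdiff W (j + 1)‖ ≤ D := sum_norm_bdiff_trapW_succ_le X₀ D _
    have h5 : 0 ≤ C₁ / (4 * Δ * ((X₀ : ℝ) + 1)) := by positivity
    calc 2 * ∑ j ∈ range (X₀ + D + 1), ‖bdiff (prev W) (j + 1 + 1)‖ * ‖bdiff a (j + 1 + 1)‖
        ≤ 2 * ∑ j ∈ range (X₀ + D + 1), ‖bdiff W (j + 1)‖ * (C₁ / (4 * Δ * ((X₀ : ℝ) + 1))) :=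
          mul_le_mul_of_nonneg_left (sum_le_sum hj) (by norm_num)
      _ = 2 * ((∑ j ∈ range (X₀ + D + 1), ‖bdiff W (j + 1)‖) * (C₁ / (4 * Δ * ((X₀ : ℝ) + 1)))) := by
          rw [sum_mul]
      _ ≤ 2 * ((D : ℝ) * (C₁ / (4 * Δ * ((X₀ : ℝ) + 1)))) :=
          mul_le_mul_of_nonneg_left (mul_le_mul_of_nonneg_right h4 h5) (by norm_num)
      _ = D * C₁ / (2 * Δ * ((X₀ : ℝ) + 1)) := by
          field_simp
          ring
  -- T3: the clamp's second variation
  have hT3 : ∑ m ∈ range (X₀ + D + 3), ‖prev (prev W) m‖ * ‖bdiff (bdiff a) m‖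
      ≤ D * ((C₂ + 4 * C₁) / (2 * Δ * A)) := by
    rw [show X₀ + D + 3 = (X₀ + D + 1) + 1 + 1 from rfl, sum_range_succ', sum_range_succ',
      prev_prev_eq_zero W (by norm_num : 0 ≤ 1), prev_prev_eq_zero W (le_refl 1), norm_zero, zero_mul, zero_mul,
      add_zero, add_zero]
    have hj : ∀ j ∈ range (X₀ + D + 1), ‖prev (prev W) (j + 1 + 1)‖ * ‖bdiff (bdiff a) (j + 1 + 1)‖
        ≤ (D : ℝ) * |locWeight g Δ e (j + 2) - 2 * locWeight g Δ e (j + 1) + locWeight g Δ e j| := by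
      intro j _
      rw [prev_succ, prev_succ, show j + 1 + 1 = j + 2 from rfl, hndda j, hW, norm_trapW]
      exact mul_le_mul_of_nonneg_right (by exact_mod_cast trapCount_le X₀ D j) (abs_nonneg _)
    refine (sum_le_sum hj).trans ?_
    rw [← mul_sum]
    exact mul_le_mul_of_nonneg_left
      (sum_abs_locWeight_second_diff_le g hΔ he hz hA hA1 hmono hvan hC₁ hC₂ _) (Nat.cast_nonneg _)
  linarith

end Summit.Parity.BatemanHorn.Theorems
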